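import Summits.Ventures.CertifiedArithmetic.Statement

/-!
# THEOREMS-R1 in Lean: exact products (Theorem P) and exact sums, coarse form (Theorem S₀)

HONEST FRAMING (venture CertifiedArithmetic / cell `pub-lowprec`): certified error envelopes and
provably optimal rounding/accumulation schemes for low-precision formats under stated cost models;
every table by two implementations; no hardware or vendor claims.

Parameter-level criteria of the cell's THEOREMS-R1.md (enum seat), PROVED over the substrate:
* `TheoremP` / `theoremP_holds` — THEOREMS-R1 Theorem P: `p_ψ ≥ p₁ + p₂`, `qexp_ψ ≤ qexp₁ + qexp₂`,
  `maxRat₁ · maxRat₂ ≤ maxRat_ψ` ⟹ every product of data of `φ₁`, `φ₂` is a value of `ψ`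
  (`R2_ExactProducts` of Statement.lean) — the value-level re-packaging of
  `MiniFloat.exists_toRat_eq_mul` (Exact.lean);
* `TheoremS0` / `theoremS0_holds` — Theorem S, coarse form: `qexp_ψ ≤ min qexp`,
  `maxRat₁ + maxRat₂ < 2^(p_ψ + min qexp)`, `maxRat₁ + maxRat₂ ≤ maxRat_ψ` ⟹ every sum is a value
  of `ψ` (`ExactSums`); the sharp span criterion (Lemma C / C′) stays in prose.
Drafted by the enum seat (HOME lean/enum/TheoremsR1Sketch.lean, rc 0, 2026-08-19T21:32Z) and
landed here by the lean seat with the cell's `R2_ExactProducts` as the product predicate.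
-/

open Literature.ComputerArithmetic.FloatingPoint

namespace Summit.Ventures.CertifiedArithmetic

/-- Every sum of finite data of `φ₁`, `φ₂` is (the value of) a finite datum of `ψ`. -/
def ExactSums (φ₁ φ₂ ψ : Format) : Prop :=
  ∀ x : MiniFloat φ₁, ∀ y : MiniFloat φ₂, ∃ z : MiniFloat ψ, z.toRat = x.toRat + y.toRat

/-- THEOREMS-R1 Theorem P: (i) `P_R ≥ P_X + P_Y`, (ii) `L_R ≤ L_X + L_Y`, (iii) `M_X M_Y ≤ M_R`
imply exact products.  (`P = manBits + 1`, `L = qexp`, `M = maxRat`.) -/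
def TheoremP : Prop :=
  ∀ φ₁ φ₂ ψ : Format,
    φ₁.manBits + φ₂.manBits + 1 ≤ ψ.manBits →
    ψ.qexp ≤ φ₁.qexp + φ₂.qexp →
    φ₁.maxRat * φ₂.maxRat ≤ ψ.maxRat →
    R2_ExactProducts φ₁ φ₂ ψ

/-- `TheoremP` is a re-packaging of the landed `MiniFloat.exists_toRat_eq_mul` (lean seat,
`LowPrec/Exact.lean`): the range hypothesis on values is converted to the one on scaled magnitudes. -/
theorem theoremP_holds : TheoremP := by
  intro φ₁ φ₂ ψ hP hL hM x y
  obtain ⟨d, hd⟩ : ∃ d : ℕ, φ₁.qexp + φ₂.qexp = ψ.qexp + d :=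
    ⟨(φ₁.qexp + φ₂.qexp - ψ.qexp).toNat, by omega⟩
  refine MiniFloat.exists_toRat_eq_mul hP hd ?_ x y
  -- range: maxScaled₁ · maxScaled₂ · 2^d ≤ maxScaled_ψ, from maxRat₁ · maxRat₂ ≤ maxRat_ψ
  have h2 : (0 : ℚ) < (2 : ℚ) ^ ψ.qexp := zpow_pos (by norm_num) _
  have hpow : (2 : ℚ) ^ φ₁.qexp * (2 : ℚ) ^ φ₂.qexp = (2 : ℚ) ^ ψ.qexp * (2 : ℚ) ^ (d : ℕ) := by
    rw [← zpow_natCast, ← zpow_add₀ two_ne_zero, ← zpow_add₀ two_ne_zero, hd]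
  have key : ((φ₁.maxScaled * φ₂.maxScaled * 2 ^ d : ℕ) : ℚ) * (2 : ℚ) ^ ψ.qexp
      ≤ (ψ.maxScaled : ℚ) * (2 : ℚ) ^ ψ.qexp := by
    unfold Format.maxRat Format.quantum at hM
    push_cast
    calc (↑φ₁.maxScaled * ↑φ₂.maxScaled * (2 : ℚ) ^ d) * (2 : ℚ) ^ ψ.qexp
        = ↑φ₁.maxScaled * (2 : ℚ) ^ φ₁.qexp * (↑φ₂.maxScaled * (2 : ℚ) ^ φ₂.qexp) := by
          rw [show (↑φ₁.maxScaled : ℚ) * (2 : ℚ) ^ φ₁.qexp * (↑φ₂.maxScaled * (2 : ℚ) ^ φ₂.qexp)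
                = ↑φ₁.maxScaled * ↑φ₂.maxScaled * ((2 : ℚ) ^ φ₁.qexp * (2 : ℚ) ^ φ₂.qexp) by ring, hpow]
          ring
      _ ≤ ↑ψ.maxScaled * (2 : ℚ) ^ ψ.qexp := hM
  exact_mod_cast le_of_mul_le_mul_right key h2

/-- THEOREMS-R1 Theorem S, coarse form: (i) `L_R ≤ min(L_X, L_Y)`, (ii₀) `M_X + M_Y < 2^(P_R + L)`
(every sum is fewer than `2^P_R` quanta of `2^L`, `L = min(L_X, L_Y)`), (iii) `M_X + M_Y ≤ M_R`
imply exact sums. -/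
def TheoremS0 : Prop :=
  ∀ φ₁ φ₂ ψ : Format,
    ψ.qexp ≤ min φ₁.qexp φ₂.qexp →
    φ₁.maxRat + φ₂.maxRat < (2 : ℚ) ^ ((ψ.manBits : ℤ) + 1 + min φ₁.qexp φ₂.qexp) →
    φ₁.maxRat + φ₂.maxRat ≤ ψ.maxRat →
    ExactSums φ₁ φ₂ ψ

/-- A signed magnitude `N · 2^j` quanta with `|N| < 2^(m+1)` and within range is a value
(signed form of `MiniFloat.representable_mul_pow`). -/
theorem exists_toRat_eq_int_mul_pow_mul_quantum {ψ : Format} {N : ℤ} {j : ℕ}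
    (hN : N.natAbs < 2 ^ (ψ.manBits + 1)) (hle : N.natAbs * 2 ^ j ≤ ψ.maxScaled) :
    ∃ z : MiniFloat ψ, z.toRat = (N : ℚ) * 2 ^ j * ψ.quantum := by
  have hrep : ψ.Representable (N.natAbs * 2 ^ j) := MiniFloat.representable_mul_pow hN hle
  refine ⟨MiniFloat.ofScaled ψ (decide (N < 0)) _ hle, ?_⟩
  rw [MiniFloat.toRat_ofScaled hle hrep]
  have hcast : ((N.natAbs : ℕ) : ℚ) = |(N : ℚ)| := by rw [Nat.cast_natAbs, Int.cast_abs]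
  by_cases hN0 : N < 0
  · have hN0' : (N : ℚ) < 0 := by exact_mod_cast hN0
    rw [if_pos (by simpa using hN0)]
    push_cast
    rw [hcast, abs_of_neg hN0']; ring
  · have hN0' : (0 : ℚ) ≤ N := by exact_mod_cast not_lt.mp hN0
    rw [if_neg (by simpa using hN0)]
    push_cast
    rw [hcast, abs_of_nonneg hN0']

/-- `TheoremS0` holds: the sum is `N · 2^j` quanta of `ψ` with `|N| < 2^(m_ψ+1)` by (ii₀) and in
range by (iii), hence a value by `representable_mul_pow`. -/
theorem theoremS0_holds : TheoremS0 := by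
  intro φ₁ φ₂ ψ hL hB hM x y
  have h1 : min φ₁.qexp φ₂.qexp ≤ φ₁.qexp := min_le_left _ _
  have h2 : min φ₁.qexp φ₂.qexp ≤ φ₂.qexp := min_le_right _ _
  obtain ⟨j, hj⟩ : ∃ j : ℕ, min φ₁.qexp φ₂.qexp = ψ.qexp + j :=
    ⟨(min φ₁.qexp φ₂.qexp - ψ.qexp).toNat, by omega⟩
  obtain ⟨a, ha⟩ : ∃ a : ℕ, φ₁.qexp = ψ.qexp + j + a :=
    ⟨(φ₁.qexp - ψ.qexp - j).toNat, by omega⟩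
  obtain ⟨b, hb⟩ : ∃ b : ℕ, φ₂.qexp = ψ.qexp + j + b :=
    ⟨(φ₂.qexp - ψ.qexp - j).toNat, by omega⟩
  -- the exact sum as a signed magnitude N · 2^j quanta of ψ
  set N : ℤ := x.toInt * 2 ^ a + y.toInt * 2 ^ b with hN
  have hq : (0 : ℚ) < ψ.quantum := ψ.quantum_pos
  have h2j : (0 : ℚ) < (2 : ℚ) ^ j := pow_pos (by norm_num) _
  have hsum : x.toRat + y.toRat = (N : ℚ) * 2 ^ j * ψ.quantum := by
    unfold MiniFloat.toRat Format.quantum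
    rw [ha, hb, hN]
    push_cast
    simp only [zpow_add₀ (two_ne_zero : (2 : ℚ) ≠ 0), zpow_natCast]
    ring
  have habs : |x.toRat + y.toRat| ≤ φ₁.maxRat + φ₂.maxRat :=
    (abs_add_le _ _).trans (add_le_add (MiniFloat.abs_toRat_le_maxRat x) (MiniFloat.abs_toRat_le_maxRat y))
  have hcastN : |(N : ℚ)| = ((N.natAbs : ℕ) : ℚ) := by rw [Nat.cast_natAbs, Int.cast_abs]
  have habs' : |x.toRat + y.toRat| = ((N.natAbs : ℕ) : ℚ) * 2 ^ j * ψ.quantum := by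
    rw [hsum, abs_mul, abs_mul, hcastN, abs_of_pos h2j, abs_of_pos hq]
  -- (a) |N| < 2^(m+1) from (ii₀)
  have hNlt : N.natAbs < 2 ^ (ψ.manBits + 1) := by
    have hpow : (2 : ℚ) ^ ((ψ.manBits : ℤ) + 1 + min φ₁.qexp φ₂.qexp)
        = (2 : ℚ) ^ (ψ.manBits + 1) * 2 ^ j * ψ.quantum := by
      unfold Format.quantum
      rw [hj]
      simp only [zpow_add₀ (two_ne_zero : (2 : ℚ) ≠ 0), zpow_natCast, zpow_one]
      ring
    have hB' : ((N.natAbs : ℕ) : ℚ) * 2 ^ j * ψ.quantum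
        < (2 : ℚ) ^ (ψ.manBits + 1) * 2 ^ j * ψ.quantum := by
      rw [← habs', ← hpow]
      exact habs.trans_lt hB
    have := lt_of_mul_lt_mul_right (lt_of_mul_lt_mul_right hB' hq.le) h2j.le
    exact_mod_cast this
  -- (b) |N| · 2^j ≤ maxScaled_ψ from (iii)
  have hle : N.natAbs * 2 ^ j ≤ ψ.maxScaled := by
    have hM' : ((N.natAbs : ℕ) : ℚ) * 2 ^ j * ψ.quantum ≤ (ψ.maxScaled : ℚ) * ψ.quantum := by
      rw [← habs']
      exact habs.trans hM
    have := le_of_mul_le_mul_right hM' hq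
    exact_mod_cast this
  obtain ⟨z, hz⟩ := exists_toRat_eq_int_mul_pow_mul_quantum hNlt hle
  exact ⟨z, hz.trans hsum.symm⟩

/-- Instance via Theorem P: `E3M2 × E3M2 → binary16` is exact (ENVELOPES.md §2, EXACT_ALL), the
value-level hypotheses being numerals. -/
theorem E3M2_mul_E3M2_exact_in_Binary16' : R2_ExactProducts Format.E3M2 Format.E3M2 Format.Binary16 :=
  theoremP_holds _ _ _ (by decide) (by decide)
    (by rw [Format.E3M2_maxRat.1, Format.Binary16_maxRat.1]; norm_num)

/-- Instance via Theorem S₀: `E2M3 + E2M3 → bfloat16` is exact (`L = -3`, `15 < 2^(8-3) = 32`,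
`15 ≤ maxRat`). -/
theorem E2M3_add_E2M3_exact_in_BFloat16 : ExactSums Format.E2M3 Format.E2M3 Format.BFloat16 := by
  refine theoremS0_holds _ _ _ (by decide) ?_ ?_
  · rw [Format.E2M3_maxRat.1]
    have h : ((Format.BFloat16.manBits : ℤ) + 1 + min Format.E2M3.qexp Format.E2M3.qexp) = 5 := by
      decide
    rw [h]; norm_num
  · rw [Format.E2M3_maxRat.1, Format.BFloat16_maxRat.1]; norm_num

/-- Instance via Theorem S₀: `E2M1 + E2M1 → binary16`, `E3M2 + E3M2 → binary32`, and
`E4M3 + E4M3 → binary32` are exact. -/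
theorem exactSums_instances :
    ExactSums Format.E2M1 Format.E2M1 Format.Binary16 ∧
    ExactSums Format.E3M2 Format.E3M2 Format.Binary32 ∧
    ExactSums Format.E4M3 Format.E4M3 Format.Binary32 := by
  refine ⟨theoremS0_holds _ _ _ (by decide) ?_ ?_, theoremS0_holds _ _ _ (by decide) ?_ ?_,
    theoremS0_holds _ _ _ (by decide) ?_ ?_⟩
  · rw [Format.E2M1_maxRat.1]
    rw [show ((Format.Binary16.manBits : ℤ) + 1 + min Format.E2M1.qexp Format.E2M1.qexp) = 10 by decide]
    norm_num
  · rw [Format.E2M1_maxRat.1, Format.Binary16_maxRat.1]; norm_num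
  · rw [Format.E3M2_maxRat.1]
    rw [show ((Format.Binary32.manBits : ℤ) + 1 + min Format.E3M2.qexp Format.E3M2.qexp) = 20 by decide]
    norm_num
  · rw [Format.E3M2_maxRat.1, Format.Binary32_maxRat.1]; norm_num
  · rw [Format.E4M3_maxRat.1]
    rw [show ((Format.Binary32.manBits : ℤ) + 1 + min Format.E4M3.qexp Format.E4M3.qexp) = 15 by decide]
    norm_num
  · rw [Format.E4M3_maxRat.1, Format.Binary32_maxRat.1]; norm_num

end Summit.Ventures.CertifiedArithmetic
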